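import Mathlib
import Literature.Computability.Complexity.ExtMonotoneGates
import Literature.Computability.Complexity.CliqueApproximatorsWide
import Literature.Computability.Complexity.RossmanMonotoneCliqueProb
import Literature.Computability.Complexity.RossmanMonotoneCliqueGraphs
import Summits.PneNP.PneNP.Theorems.ConvexRankGatesLinAlgGateBlindDefs

/-!
# Stub `stub_wideApproxHost` of line `dnf-invariant-wide-gates-see-small-cliques` for crux `LinAlgGateBlind` (stmt-PneNP-10681, route ConvexRankGates)

THE HOST of the line: Razborov's approximation method (Alon–Boppana 1987, Thm. 2.1) run along a
straight-line program over `{∧₂, ∨₂} ∪ W` for an ARBITRARY set `W` of MONOTONE wide gates, in the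
lattice `K(m, r, l)` of closed families (`Razborov.IsClosedFamily`, `Razborov.closure`), with
ONE-SIDED errors on the referee pair POSITIVES = bare `k`-cliques `cliqueVec S`, `#S = k` (the lost
ones are COUNTED in a global finset `BadP`), NEGATIVES = the product measure `prob q` on
`KEdge m → Bool` (the gained ones are collected in a global EVENT `BadN` with a probability budget).

* The invariant of a wire carrying the Boolean function `v` and the family `F` (spelled out as a
  conjunction, no new definition): `F ∈ K(m, r, l)`; off `BadN`, `⌈F⌉(x) → v x = 1`; every `k`-set
  `S` with `v(K_S) = 1` has `⌈F⌉(K_S)` or lies in `BadP`. It is exact at the inputs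
  (`inputFamily`, `inv_input`), and is pushed through `∧ ↦ F₁ ∩ F₂` (new lost cliques
  `errPos k F₁ F₂`, `inv_and`), `∨ ↦ (F₁ ∪ F₂)*` (new gained event `⌈(F₁ ∪ F₂)*⌉ ∧ ¬⌈F₁ ∪ F₂⌉`,
  `inv_or`), and through a monotone gate `g ∈ W` replaced by the closed family `F` supplied by
  `GateApprox` at the families `A_a` of its children (new lost cliques `lostPos`, new gained event
  `[g(⌈A_a⌉) = 0 ∧ ⌈F⌉]`, i.e. the event of `gainedNeg`; MONOTONICITY of `g` transports the
  children's one-sided guarantees through `g`: `inv_wide`).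
* `exists_inv_gates`: the induction along the program (`List.reverseRecOn`, line by line as the
  tree's `exists_rApprox_gates_wide`), with the accounting `#BadP ≤ n · εP · C(m,k)` and
  `Pr[BadN] ≤ n · εN` from the hypotheses `h∧`, `h∨` and `GateApprox` (`card_union_le`, `prob_or_le`).
* `stub_wideApproxHost` (the registered signature): the endgame for a circuit computing
  `cliqueFn m k`. If the output family is `∅`, every `k`-set is lost (`cliqueFn_cliqueVec`), so
  `C(m,k) ≤ #BadP ≤ t εP C(m,k) < C(m,k)` (`k ≤ m`); otherwise it contains some `X ∈ 𝒱(l)` and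
  `q^{C(l,2)} ≤ q^{#E(K_X)} = Pr[⌈X⌉] ≤ Pr[⌈F⌉] ≤ Pr[BadN] + Pr[CLIQUE = 1] ≤ t εN + Pr[CLIQUE = 1]`,
  contradicting the last budget (`prob_forall_eq_true`, `card_edgesIn_le`, `prob_mono`, `prob_or_le`).

Template: `Literature/Computability/Complexity/CliqueApproximatorsWide.lean`
(`exists_rApprox_gates_wide`, `exists_rApprox_circuit_wide`, `razborov_dichotomy_wide`), whose
colouring side is replaced by the product measure. Sources: A. A. Razborov (1985); N. Alon,
R. B. Boppana, Combinatorica 7 (1987), Thm. 2.1 and §3. No new definitions; nothing is assumed.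
-/

-- `Summit.PneNP.PneNP.…` duplicates `PneNP` BY DESIGN (single-problem summit).
set_option linter.dupNamespace false

noncomputable section

namespace Summit.PneNP.PneNP.Cruxes.LinAlgGateBlind.DnfInvariantWideGatesSeeSmallCliques

open Finset Literature.Computability.Complexity Razborov GateList

/-! ### The one-sided invariant of a wire: inputs, `∧`, `∨` and wide monotone gates -/

section Steps

variable {m r l k : ℕ} {BadP BadP' : Finset (Finset (Fin m))} {BadN BadN' : (KEdge m → Bool) → Prop}
  {F F₁ F₂ : Finset (Finset (Fin m))} {v v' u w : (KEdge m → Bool) → Bool}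

/-- `acceptsB 𝒜` is the Boolean indicator of `Accepts 𝒜` (the small-clique DNF `⌈𝒜⌉`). [folklore] -/
theorem host_acceptsB_eq_true_iff (𝒜 : Finset (Finset (Fin m))) (x : KEdge m → Bool) :
    acceptsB 𝒜 x = true ↔ Accepts 𝒜 x := by
  simp [acceptsB]

/-- The wire invariant is monotone in the two global error collectors and extensional in the value
of the wire (Alon–Boppana 1987, proof of Thm. 2.1, bookkeeping). [folklore] -/
theorem inv_mono
    (h : IsClosedFamily r l F ∧ (∀ x : KEdge m → Bool, ¬ BadN x → Accepts F x → v x = true) ∧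
      ∀ S : Finset (Fin m), #S = k → v (cliqueVec S) = true → Accepts F (cliqueVec S) ∨ S ∈ BadP)
    (hP : BadP ⊆ BadP') (hN : ∀ x, BadN x → BadN' x) (hv : ∀ x, v x = v' x) :
    IsClosedFamily r l F ∧ (∀ x : KEdge m → Bool, ¬ BadN' x → Accepts F x → v' x = true) ∧
      ∀ S : Finset (Fin m), #S = k → v' (cliqueVec S) = true →
        Accepts F (cliqueVec S) ∨ S ∈ BadP' :=
  ⟨h.1, fun x hx hF => (hv x).symm.trans (h.2.1 x (fun hb => hx (hN x hb)) hF),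
    fun S hS hvS => (h.2.2 S hS ((hv _).trans hvS)).imp_right fun hb => hP hb⟩

/-- **Inputs** (Alon–Boppana 1987, Thm. 2.1, case `t = 0`): the input approximator
`inputFamily l e` of the edge `e` makes no error at all (positives: `RApprox.input`, needs
`r, l ≥ 2`; negatives: a member of `inputFamily l e` contains both endpoints of `e`). [folklore] -/
theorem inv_input (hr : 2 ≤ r) (hl : 2 ≤ l) (e : KEdge m) :
    IsClosedFamily r l (inputFamily l e) ∧
      (∀ x : KEdge m → Bool, ¬ BadN x → Accepts (inputFamily l e) x → x e = true) ∧
      ∀ S : Finset (Fin m), #S = k → cliqueVec S e = true →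
        Accepts (inputFamily l e) (cliqueVec S) ∨ S ∈ BadP :=
  ⟨isClosedFamily_inputFamily hr l e,
    fun x _ hx => by
      obtain ⟨W, hW, hP⟩ := hx
      exact hP e (mem_filter.1 hW).2,
    (RApprox.input (s := k) (g := 0) (BadZ := BadP) (BadO := ∅) hr hl e).pos⟩

/-- **AND gates** (Alon–Boppana 1987, Thm. 2.1 with the meet `[A] ⊓ [B] = [A ∩ B]` of Lemma 3.1):
no new gained negatives; the new lost cliques are `errPos k F₁ F₂`. [folklore] -/
theorem inv_and
    (hu : IsClosedFamily r l F₁ ∧ (∀ x : KEdge m → Bool, ¬ BadN x → Accepts F₁ x → u x = true) ∧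
      ∀ S : Finset (Fin m), #S = k → u (cliqueVec S) = true → Accepts F₁ (cliqueVec S) ∨ S ∈ BadP)
    (hw : IsClosedFamily r l F₂ ∧ (∀ x : KEdge m → Bool, ¬ BadN x → Accepts F₂ x → w x = true) ∧
      ∀ S : Finset (Fin m), #S = k → w (cliqueVec S) = true → Accepts F₂ (cliqueVec S) ∨ S ∈ BadP) :
    IsClosedFamily r l (F₁ ∩ F₂) ∧
      (∀ x : KEdge m → Bool, ¬ BadN x → Accepts (F₁ ∩ F₂) x → (u x && w x) = true) ∧
      ∀ S : Finset (Fin m), #S = k → (u (cliqueVec S) && w (cliqueVec S)) = true →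
        Accepts (F₁ ∩ F₂) (cliqueVec S) ∨ S ∈ BadP ∪ errPos k F₁ F₂ := by
  refine ⟨hu.1.inter hw.1, fun x hx hF => ?_, fun S hS hv => ?_⟩
  · rw [Bool.and_eq_true]
    exact ⟨hu.2.1 x hx (hF.mono inter_subset_left), hw.2.1 x hx (hF.mono inter_subset_right)⟩
  · rw [Bool.and_eq_true] at hv
    rcases hu.2.2 S hS hv.1 with h1 | h1
    · rcases hw.2.2 S hS hv.2 with h2 | h2
      · by_cases h12 : Accepts (F₁ ∩ F₂) (cliqueVec S)
        · exact Or.inl h12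
        · exact Or.inr (mem_union_right _ (mem_errPos.2 ⟨hS, h1, h2, h12⟩))
      · exact Or.inr (mem_union_left _ h2)
    · exact Or.inr (mem_union_left _ h1)

/-- **OR gates** (Alon–Boppana 1987, Thm. 2.1 with the join `[A] ⊔ [B] = [(A ∪ B)*]` of
Lemma 3.1): no new lost cliques; the new gained negatives are the event
`⌈(F₁ ∪ F₂)*⌉(x) ∧ ¬ ⌈F₁ ∪ F₂⌉(x)`. [folklore] -/
theorem inv_or
    (hu : IsClosedFamily r l F₁ ∧ (∀ x : KEdge m → Bool, ¬ BadN x → Accepts F₁ x → u x = true) ∧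
      ∀ S : Finset (Fin m), #S = k → u (cliqueVec S) = true → Accepts F₁ (cliqueVec S) ∨ S ∈ BadP)
    (hw : IsClosedFamily r l F₂ ∧ (∀ x : KEdge m → Bool, ¬ BadN x → Accepts F₂ x → w x = true) ∧
      ∀ S : Finset (Fin m), #S = k → w (cliqueVec S) = true → Accepts F₂ (cliqueVec S) ∨ S ∈ BadP) :
    IsClosedFamily r l (closure r l (F₁ ∪ F₂)) ∧
      (∀ x : KEdge m → Bool,
        ¬ (BadN x ∨ (Accepts (closure r l (F₁ ∪ F₂)) x ∧ ¬ Accepts (F₁ ∪ F₂) x)) →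
        Accepts (closure r l (F₁ ∪ F₂)) x → (u x || w x) = true) ∧
      ∀ S : Finset (Fin m), #S = k → (u (cliqueVec S) || w (cliqueVec S)) = true →
        Accepts (closure r l (F₁ ∪ F₂)) (cliqueVec S) ∨ S ∈ BadP := by
  have hsub : F₁ ∪ F₂ ⊆ smallSets (Fin m) l := union_subset hu.1.subset hw.1.subset
  refine ⟨isClosedFamily_closure r l _, fun x hx hF => ?_, fun S hS hv => ?_⟩
  · have hN : ¬ BadN x := fun h => hx (Or.inl h)
    have hacc : Accepts (F₁ ∪ F₂) x := by
      by_contra h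
      exact hx (Or.inr ⟨hF, h⟩)
    rw [Bool.or_eq_true]
    rcases accepts_union_iff.1 hacc with h | h
    · exact Or.inl (hu.2.1 x hN h)
    · exact Or.inr (hw.2.1 x hN h)
  · rw [Bool.or_eq_true] at hv
    rcases hv with hv | hv
    · rcases hu.2.2 S hS hv with h | h
      · exact Or.inl ((h.mono subset_union_left).mono (subset_closure hsub))
      · exact Or.inr h
    · rcases hw.2.2 S hS hv with h | h
      · exact Or.inl ((h.mono subset_union_right).mono (subset_closure hsub))
      · exact Or.inr h

/-- **Wide monotone gates.** A monotone gate `g` whose children carry the invariant with families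
`A_a` is replaced by any closed family `F`; the new lost cliques are
`lostPos m k (g ∘ ⌈A_·⌉) F` and the new gained negatives are the event `g(⌈A_a⌉(x))_a = 0 ∧ ⌈F⌉(x)`
of `gainedNeg`. Monotonicity of `g` transports the children's one-sided guarantees: off `BadP` the
children's values at a `k`-clique are below `⌈A_a⌉`, and off `BadN` the `⌈A_a⌉` are below the
children's values. [folklore] -/
theorem inv_wide {g : GateFn} (hg : Monotone g.2) {A : Fin g.1 → Finset (Finset (Fin m))}
    {u : Fin g.1 → (KEdge m → Bool) → Bool}
    (hA : ∀ a, IsClosedFamily r l (A a) ∧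
      (∀ x : KEdge m → Bool, ¬ BadN x → Accepts (A a) x → u a x = true) ∧
      ∀ S : Finset (Fin m), #S = k → u a (cliqueVec S) = true →
        Accepts (A a) (cliqueVec S) ∨ S ∈ BadP)
    (hF : IsClosedFamily r l F) :
    IsClosedFamily r l F ∧
      (∀ x : KEdge m → Bool,
        ¬ (BadN x ∨ (g.2 (fun a => acceptsB (A a) x) = false ∧ Accepts F x)) →
        Accepts F x → g.2 (fun a => u a x) = true) ∧
      ∀ S : Finset (Fin m), #S = k → g.2 (fun a => u a (cliqueVec S)) = true →
        Accepts F (cliqueVec S) ∨ S ∈ BadP ∪ lostPos m k (fun x => g.2 fun a => acceptsB (A a) x) F := by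
  refine ⟨hF, fun x hx hFx => ?_, fun S hS hv => ?_⟩
  · have hN : ¬ BadN x := fun h => hx (Or.inl h)
    cases hO : g.2 (fun a => acceptsB (A a) x) with
    | false => exact absurd (Or.inr ⟨hO, hFx⟩) hx
    | true =>
      have hle : ∀ a, acceptsB (A a) x ≤ u a x := fun a =>
        Bool.le_iff_imp.2 fun ha => (hA a).2.1 x hN ((host_acceptsB_eq_true_iff _ _).1 ha)
      exact Bool.eq_true_of_true_le (hO.symm.le.trans (hg (Pi.le_def.2 hle)))
  · by_cases hSB : S ∈ BadP
    · exact Or.inr (mem_union_left _ hSB)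
    have hle : ∀ a, u a (cliqueVec S) ≤ acceptsB (A a) (cliqueVec S) := fun a =>
      Bool.le_iff_imp.2 fun ha =>
        (host_acceptsB_eq_true_iff _ _).2 (((hA a).2.2 S hS ha).resolve_right hSB)
    have hO : g.2 (fun a => acceptsB (A a) (cliqueVec S)) = true :=
      Bool.eq_true_of_true_le (hv.symm.le.trans (hg (Pi.le_def.2 hle)))
    by_cases hacc : Accepts F (cliqueVec S)
    · exact Or.inl hacc
    · refine Or.inr (mem_union_right _ ?_)
      simp only [lostPos, mem_filter, mem_powersetCard]
      exact ⟨⟨subset_univ _, hS⟩, hO, hacc⟩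

end Steps

/-! ### The induction along a straight-line program over `{∧₂, ∨₂} ∪ W` -/

/-- **Approximating a whole program over `{∧₂, ∨₂} ∪ W`** (Alon–Boppana 1987, proof of Thm. 2.1
in `K(m, r, l)`, with wide monotone gates and one-sided errors on (bare `k`-cliques) × `G(m, q)`):
for a well-formed gate list `gs` over `{∧₂, ∨₂} ∪ W` there are closed approximators `ap w` of all
wires, a finset `BadP` of lost `k`-sets with `#BadP ≤ |gs| · εP · C(m, k)` and an event `BadN` of
gained graphs with `Pr_q[BadN] ≤ |gs| · εN`, such that every valid wire satisfies the invariant.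
The per-gate error bounds are the hypotheses `h∨` (closure of a union of two closed families),
`h∧` (`errPos` of two closed families) and `GateApprox` (gates of `W` fed with closed families).
[folklore] -/
theorem exists_inv_gates :
    ∀ (m k r l : ℕ) (q εP εN : ℝ) (W : Set GateFn),
      2 ≤ r → 2 ≤ l → 0 ≤ q → q ≤ 1 → 0 ≤ εP → 0 ≤ εN →
      (∀ g ∈ W, Monotone g.2) →
      (∀ A B : Finset (Finset (Fin m)), IsClosedFamily r l A → IsClosedFamily r l B →
        prob q (fun x : KEdge m → Bool => Accepts (closure r l (A ∪ B)) x ∧ ¬ Accepts (A ∪ B) x) ≤ εN) →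
      (∀ A B : Finset (Finset (Fin m)), IsClosedFamily r l A → IsClosedFamily r l B →
        (#(errPos k A B) : ℝ) ≤ εP * (m.choose k : ℝ)) →
      (∀ g ∈ W, GateApprox m k r l q εP εN g) →
      ∀ gs : List (Gate (KEdge m)), GateList.WF gs → (∀ gt ∈ gs, gt.fn ∈ monotoneBasis ∪ W) →
        ∃ (ap : KEdge m ⊕ ℕ → Finset (Finset (Fin m))) (BadP : Finset (Finset (Fin m)))
          (BadN : (KEdge m → Bool) → Prop),
          (#BadP : ℝ) ≤ (gs.length : ℝ) * (εP * (m.choose k : ℝ)) ∧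
          prob q BadN ≤ (gs.length : ℝ) * εN ∧
          ∀ w : KEdge m ⊕ ℕ, GateList.OutOK gs.length w →
            IsClosedFamily r l (ap w) ∧
            (∀ x : KEdge m → Bool, ¬ BadN x → Accepts (ap w) x →
              GateList.wireOf x (GateList.vals gs x) w = true) ∧
            ∀ S : Finset (Fin m), #S = k →
              GateList.wireOf (cliqueVec S) (GateList.vals gs (cliqueVec S)) w = true →
              Accepts (ap w) (cliqueVec S) ∨ S ∈ BadP := by
  intro m k r l q εP εN W hr hl hq0 hq1 hεP hεN hW hOr hAnd hGA gs
  induction gs using List.reverseRecOn with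
  | nil =>
    intro _ _
    refine ⟨fun w => match w with
      | .inl e => inputFamily l e
      | .inr _ => ∅, ∅, fun _ => False, by simp, by simp [prob_false], fun w hw => ?_⟩
    rcases w with e | n
    · exact inv_input hr hl e
    · exact absurd (hw n rfl) (by simp)
  | append_singleton gs gt ih =>
    intro hwf hB
    obtain ⟨ap, BadP, BadN, hcP, hcN, hinv⟩ :=
      ih hwf.of_append_left fun g' hg' => hB g' (List.mem_append_left _ hg')
    have hgOK : GateOK gs.length gt := hwf.gateOK_mid (post := [])
    have hgB : gt.fn ∈ monotoneBasis ∪ W := hB gt (by simp)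
    have hlen : ((gs ++ [gt]).length : ℝ) = gs.length + 1 := by simp
    -- the value of the new gate
    have hnew : ∀ x, wireOf x (vals (gs ++ [gt]) x) (.inr gs.length) =
        gt.op (fun a => wireOf x (vals gs x) (gt.args a)) := fun x => by
      rw [wireOf_inr, show gs ++ [gt] = gs ++ gt :: [] from rfl, getD_vals_append_cons]
    -- how to assemble the conclusion from an approximator `Fn` of the new gate (value `val`)
    have assemble : ∀ (BadP' : Finset (Finset (Fin m))) (BadN' : (KEdge m → Bool) → Prop)
        (Fn : Finset (Finset (Fin m))) (val : (KEdge m → Bool) → Bool),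
        BadP ⊆ BadP' → (∀ x, BadN x → BadN' x) →
        (#BadP' : ℝ) ≤ (gs.length + 1) * (εP * (m.choose k : ℝ)) →
        prob q BadN' ≤ (gs.length + 1) * εN →
        (IsClosedFamily r l Fn ∧ (∀ x : KEdge m → Bool, ¬ BadN' x → Accepts Fn x → val x = true) ∧
          ∀ S : Finset (Fin m), #S = k → val (cliqueVec S) = true →
            Accepts Fn (cliqueVec S) ∨ S ∈ BadP') →
        (∀ x, val x = gt.op fun a => wireOf x (vals gs x) (gt.args a)) →
        ∃ (ap : KEdge m ⊕ ℕ → Finset (Finset (Fin m))) (BadP : Finset (Finset (Fin m)))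
          (BadN : (KEdge m → Bool) → Prop),
          (#BadP : ℝ) ≤ ((gs ++ [gt]).length : ℝ) * (εP * (m.choose k : ℝ)) ∧
          prob q BadN ≤ ((gs ++ [gt]).length : ℝ) * εN ∧
          ∀ w : KEdge m ⊕ ℕ, OutOK (gs ++ [gt]).length w →
            IsClosedFamily r l (ap w) ∧
            (∀ x : KEdge m → Bool, ¬ BadN x → Accepts (ap w) x →
              wireOf x (vals (gs ++ [gt]) x) w = true) ∧
            ∀ S : Finset (Fin m), #S = k →
              wireOf (cliqueVec S) (vals (gs ++ [gt]) (cliqueVec S)) w = true →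
              Accepts (ap w) (cliqueVec S) ∨ S ∈ BadP := by
      intro BadP' BadN' Fn val hPP' hNN' hcP' hcN' hFn hval
      refine ⟨fun w => if w = .inr gs.length then Fn else ap w, BadP', BadN',
        by rw [hlen]; exact hcP', by rw [hlen]; exact hcN', fun w hw => ?_⟩
      by_cases hwn : w = .inr gs.length
      · subst hwn
        dsimp only
        rw [if_pos rfl]
        exact inv_mono hFn Subset.rfl (fun _ h => h) fun x => (hval x).trans (hnew x).symm
      · dsimp only
        rw [if_neg hwn]
        have hw' : OutOK gs.length w := fun n hn => by
          have h1 := hw n hn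
          have h2 : n ≠ gs.length := fun h => hwn (hn.trans (by rw [h]))
          simp only [List.length_append, List.length_singleton] at h1
          omega
        exact inv_mono (hinv w hw') hPP' hNN' fun x => (wireOf_vals_append gs [gt] x w hw').symm
    -- accounting
    have hmonoP : (gs.length : ℝ) * (εP * (m.choose k : ℝ)) ≤
        (gs.length + 1) * (εP * (m.choose k : ℝ)) :=
      mul_le_mul_of_nonneg_right (lt_add_one _).le (mul_nonneg hεP (Nat.cast_nonneg _))
    have hmonoN : (gs.length : ℝ) * εN ≤ (gs.length + 1) * εN :=
      mul_le_mul_of_nonneg_right (lt_add_one _).le hεN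
    have accP : ∀ E : Finset (Finset (Fin m)), (#E : ℝ) ≤ εP * (m.choose k : ℝ) →
        (#(BadP ∪ E) : ℝ) ≤ (gs.length + 1) * (εP * (m.choose k : ℝ)) := fun E hE =>
      calc (#(BadP ∪ E) : ℝ) ≤ (#BadP : ℝ) + (#E : ℝ) := by exact_mod_cast card_union_le _ _
        _ ≤ gs.length * (εP * (m.choose k : ℝ)) + εP * (m.choose k : ℝ) := add_le_add hcP hE
        _ = (gs.length + 1) * (εP * (m.choose k : ℝ)) := by ring
    have accN : ∀ E : (KEdge m → Bool) → Prop, prob q E ≤ εN →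
        prob q (fun x => BadN x ∨ E x) ≤ (gs.length + 1) * εN := fun E hE =>
      calc prob q (fun x => BadN x ∨ E x) ≤ prob q BadN + prob q E := prob_or_le hq0 hq1 _ _
        _ ≤ gs.length * εN + εN := add_le_add hcN hE
        _ = (gs.length + 1) * εN := by ring
    simp only [Set.mem_union, monotoneBasis, Set.mem_insert_iff, Set.mem_singleton_iff] at hgB
    rcases hgB with (hc | hc) | hgW
    · -- AND gate: `F_u ∩ F_v`; the new lost cliques are `errPos k F_u F_v` (hypothesis `h∧`)
      obtain ⟨wu, wv, rfl⟩ := exists_eq_andGate_of_fn_eq hc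
      have hu : OutOK gs.length wu := fun n hn => hgOK (0 : Fin 2) n hn
      have hv : OutOK gs.length wv := fun n hn => hgOK (1 : Fin 2) n hn
      exact assemble _ BadN _ _ subset_union_left (fun _ h => h)
        (accP _ (hAnd _ _ (hinv wu hu).1 (hinv wv hv).1)) (hcN.trans hmonoN)
        (inv_and (hinv wu hu) (hinv wv hv)) fun x => (andGate_op wu wv (wireOf x (vals gs x))).symm
    · -- OR gate: `(F_u ∪ F_v)*`; the new gained event is `⌈(F_u ∪ F_v)*⌉ ∧ ¬⌈F_u ∪ F_v⌉` (`h∨`)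
      obtain ⟨wu, wv, rfl⟩ := exists_eq_orGate_of_fn_eq hc
      have hu : OutOK gs.length wu := fun n hn => hgOK (0 : Fin 2) n hn
      have hv : OutOK gs.length wv := fun n hn => hgOK (1 : Fin 2) n hn
      exact assemble BadP _ _ _ Subset.rfl (fun _ h => Or.inl h) (hcP.trans hmonoP)
        (accN _ (hOr _ _ (hinv wu hu).1 (hinv wv hv).1))
        (inv_or (hinv wu hu) (hinv wv hv)) fun x => (orGate_op wu wv (wireOf x (vals gs x))).symm
    · -- a gate of `W`: replaced by the closed family supplied by `GateApprox` at its children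
      obtain ⟨F, hF, hlost, hgain⟩ :=
        hGA gt.fn hgW (fun a => ap (gt.args a)) fun a => (hinv _ (hgOK a)).1
      exact assemble _ _ F _ subset_union_left (fun _ h => Or.inl h) (accP _ hlost) (accN _ hgain)
        (inv_wide (hW gt.fn hgW) (fun a => hinv _ (hgOK a)) hF) fun _ => rfl

/-! ### The endgame -/

/-- **Stub 3 of the line — the host: Razborov / Alon–Boppana bookkeeping with wide gates and the
endgame.** Let `W` be a set of monotone gates, each with the per-gate interface `GateApprox` in
`K(m, r, l)` (`2 ≤ r`, `2 ≤ l`, `k ≤ m`, `q ∈ [0, 1]`), let closures of unions of two closed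
families gain `≤ εN` of `G(m, q)` (`h∨`) and intersections lose `≤ εP · C(m, k)` bare `k`-cliques
(`h∧`), and let `t εP < 1` and `t εN + Pr_q[CLIQUE(m,k) = 1] < q^{C(l,2)}`. Then no circuit with
`≤ t` gates over `{∧₂, ∨₂} ∪ W` computes `CLIQUE(m, k)`: by `exists_inv_gates` its output wire
carries a closed family `F` with `#BadP ≤ t εP C(m,k)` and `Pr[BadN] ≤ t εN`; if `F = ∅` every
`k`-set is lost, so `C(m,k) ≤ #BadP < C(m,k)`; if `X ∈ F` then
`q^{C(l,2)} ≤ Pr[⌈X⌉] ≤ Pr[⌈F⌉] ≤ Pr[BadN] + Pr[CLIQUE = 1] < q^{C(l,2)}`. [folklore] -/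
theorem stub_wideApproxHost :
    ∀ (m k r l t : ℕ) (q εP εN : ℝ) (W : Set GateFn),
      2 ≤ r → 2 ≤ l → k ≤ m → 0 ≤ q → q ≤ 1 → 0 ≤ εP → 0 ≤ εN →
      (∀ g ∈ W, Monotone g.2) →
      (∀ A B : Finset (Finset (Fin m)), IsClosedFamily r l A → IsClosedFamily r l B →
        prob q (fun x : KEdge m → Bool => Accepts (closure r l (A ∪ B)) x ∧ ¬ Accepts (A ∪ B) x) ≤ εN) →
      (∀ A B : Finset (Finset (Fin m)), IsClosedFamily r l A → IsClosedFamily r l B →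
        (#(errPos k A B) : ℝ) ≤ εP * (m.choose k : ℝ)) →
      (∀ g ∈ W, GateApprox m k r l q εP εN g) →
      (t : ℝ) * εP < 1 →
      (t : ℝ) * εN + prob q (fun x : KEdge m → Bool => cliqueFn m k x = true) < q ^ (l.choose 2) →
      ∀ C : Circuit (KEdge m), C.IsOver (monotoneBasis ∪ W) → C.size ≤ t →
        ¬ C.Computes (cliqueFn m k) := by
  intro m k r l t q εP εN W hr hl hkm hq0 hq1 hεP hεN hW hOr hAnd hGA htP htN C hC hsize hcomp
  obtain ⟨ap, BadP, BadN, hcP, hcN, hinv⟩ := exists_inv_gates m k r l q εP εN W hr hl hq0 hq1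
    hεP hεN hW hOr hAnd hGA C.gates (wf_gates C) hC
  obtain ⟨hFc, hneg, hpos⟩ := hinv C.output C.wf_output
  have hev : ∀ x, wireOf x (vals C.gates x) C.output = cliqueFn m k x := fun x =>
    (circuit_eval C x).symm.trans (hcomp x)
  have hsz : (C.gates.length : ℝ) ≤ t := by exact_mod_cast hsize
  have hBadP : (#BadP : ℝ) ≤ t * (εP * (m.choose k : ℝ)) :=
    hcP.trans (mul_le_mul_of_nonneg_right hsz (mul_nonneg hεP (Nat.cast_nonneg _)))
  have hBadN : prob q BadN ≤ (t : ℝ) * εN := hcN.trans (mul_le_mul_of_nonneg_right hsz hεN)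
  rcases (ap C.output).eq_empty_or_nonempty with hF0 | ⟨X, hX⟩
  · -- the output family is empty: every `k`-set is lost
    have hall : powersetCard k (univ : Finset (Fin m)) ⊆ BadP := fun S hS => by
      have hSk : #S = k := (mem_powersetCard.1 hS).2
      rcases hpos S hSk (by rw [hev]; exact cliqueFn_cliqueVec hSk.ge) with ⟨Y, hY, -⟩ | hb
      · rw [hF0] at hY
        exact absurd hY (notMem_empty Y)
      · exact hb
    have hcard : (m.choose k : ℝ) ≤ #BadP := by
      have h := card_le_card hall
      rw [card_powersetCard, card_univ, Fintype.card_fin] at h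
      exact_mod_cast h
    have hchoose : (0 : ℝ) < m.choose k := by exact_mod_cast Nat.choose_pos hkm
    have h1 : (m.choose k : ℝ) ≤ (t : ℝ) * εP * (m.choose k : ℝ) := by
      rw [mul_assoc]
      exact hcard.trans hBadP
    have h2 : (t : ℝ) * εP * (m.choose k : ℝ) < 1 * (m.choose k : ℝ) :=
      mul_lt_mul_of_pos_right htP hchoose
    linarith
  · -- the output family contains some `X ∈ 𝒱(l)`: its atom is likely under `G(m, q)`
    have hXl : #X ≤ l := (mem_smallSets.1 (hFc.subset hX)).1
    have hlow : q ^ (l.choose 2) ≤ prob q (fun x : KEdge m → Bool => Accepts (ap C.output) x) :=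
      calc q ^ (l.choose 2) ≤ q ^ #(edgesIn X) :=
            pow_le_pow_of_le_one hq0 hq1 ((card_edgesIn_le X).trans (Nat.choose_le_choose 2 hXl))
        _ = prob q (fun x : KEdge m → Bool => ∀ e ∈ edgesIn X, x e = true) :=
            (prob_forall_eq_true q (edgesIn X)).symm
        _ = prob q (fun x : KEdge m → Bool => CliquePresent X x) :=
            prob_congr fun x => by simp [edgesIn, CliquePresent, IsLive, Finset.subset_iff]
        _ ≤ prob q (fun x : KEdge m → Bool => Accepts (ap C.output) x) :=
            prob_mono hq0 hq1 fun x hx => ⟨X, hX, hx⟩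
    have hup : prob q (fun x : KEdge m → Bool => Accepts (ap C.output) x) ≤
        prob q BadN + prob q (fun x : KEdge m → Bool => cliqueFn m k x = true) := by
      refine (prob_mono hq0 hq1 fun x hx => ?_).trans (prob_or_le hq0 hq1 _ _)
      by_cases hB : BadN x
      · exact Or.inl hB
      · exact Or.inr ((hev x).symm.trans (hneg x hB hx))
    linarith

end Summit.PneNP.PneNP.Cruxes.LinAlgGateBlind.DnfInvariantWideGatesSeeSmallCliques

end
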